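import Mathlib
import Summits.NavierStokesRegularity.NavierStokesRegularity.Theorems.SubOnsagerCeilingSideBranchChainDrive
import HarnessLib

/-!
# Route SubOnsagerCeiling — a CAPPED POCKET FORBIDS A LINGERING CHAIN MODE in `α_SB`
# (helper file for item stmt-NavierStokesRegularity-25507 `OrthantTailCeiling`; `--supports`; def-free)

Brick of the ENGINE behind the negative lemmas of the aside cruxes `OrthantTailCeiling` /
`ForwardTailCeiling` (p824789 / p824871, reduced to per-shell retention by p825506).  Under the assumed
ceiling every dead-end pocket is CAPPED, `z_{k+1} ≤ Z_k = √(2CE₀)(1+ε₀)^{-θ(k+1)}`.  This file turns a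
pocket cap into a bound on how long the chain mode `x_k` can stay on — the rigorous skeleton of the
scaling law `z³ ≍ Λ_k ∫ x_k⁴` of the numerical refutation (`Cruxes/OrthantTailCeiling/REFUTATION-EVIDENCE.md`
§3): while `Λ_k x_k² ≥ a`, the (barely drained) side mode rises to `m = a/(5r₁)`,
`r₁ = Λ_k Z/5 + ν_k`, and then the pocket gains `(Λ_k/5)m²` per unit time, which the cap forbids for long:

* `sideBranch_sq_lower_of_drive` — calculus: `s ≥ m(1 − e^{−r(u−t₀)})` with `m ≥ 0` gives, after the
  delay `log 2 / r`, `s² ≥ m²(1 − e^{−r(u−t₀−log 2/r)})`;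
* `sideBranch_linger_bound` — along a regular `ν`-viscous solution on `[0,s]` (`ν ≥ 0`), if on
  `[t₀,t₁] ⊆ [0,s]`: `Λ_k x_k² ≥ a ≥ 0`, `s_k ≥ 0`, `0 ≤ z_{k+1} ≤ Z` (`Z > 0`), then
  **`(Λ_k/5)·(a/(5r₁))²·((t₁ − t₀) − (1 + log 2)/r₁) ≤ Z·(1 + ν_{k+1}(t₁ − t₀))`**, `r₁ = Λ_kZ/5 + ν_k`.
  In the inviscid limit: `a²·(t₁−t₀) ≲ 5Λ_k Z³ + 8.5 a²/(Λ_k Z)` — the fourth-moment occupation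
  `Λ_k x_k⁴·Δt ≍ a²Δt/Λ_k` of a chain mode beside a pocket capped at `Z` is `O(Z³)`.

Use (not carried out here): under a `(θ,C)` ceiling the caps `Z_k³ ≍ (CE₀)^{3/2}b^{-3θk}` are far below
the Kolmogorov occupation `≍ b^{-5k/6}` of a conveyor carrying a fixed fraction of `E₀`, so a
ceiling-obeying solution cannot run a Kolmogorov conveyor through deep shells; what is missing to close
the refutation is the complementary LOWER bound on the conveyor (per-shell retention, p825506).

HONEST FRAMING: elementary real analysis of a Tao-type MODEL lattice ODE (route SubOnsagerCeiling, rung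
TL-M2Break); a brick toward a construction that is NOT carried out here; nothing bears on Navier–Stokes
regularity; no crux is settled here. [cite: Tao2016AveragedNS, §4 (4.2)–(4.3)];
Katz–Pavlović couplings: [cite: BarbatoMorandinRomito2011, §2].
-/

noncomputable section

-- the sub-problem namespace `NavierStokesRegularity.NavierStokesRegularity` is the tree's layout (D-0017)
set_option linter.dupNamespace false

namespace Summit.NavierStokesRegularity.NavierStokesRegularity.Theorems.SubOnsagerCeiling

open Set
open Literature.Analysis.FluidPDE.TaoCascade

/-! ## One piece of calculus -/

/-- **Squaring a drive bound after a delay.** If `s u ≥ m(1 − e^{−r(u−t₀)})` with `m ≥ 0`, `r > 0`, and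
`u ≥ t₀ + log 2 / r`, then `s u ² ≥ m²(1 − e^{−r(u − (t₀ + log 2/r))})`. [folklore] -/
theorem sideBranch_sq_lower_of_drive {s : ℝ → ℝ} {m r t₀ u : ℝ} (hm : 0 ≤ m) (hr : 0 < r)
    (hs : m * (1 - Real.exp (-(r * (u - t₀)))) ≤ s u) (hu : t₀ + Real.log 2 / r ≤ u) :
    m ^ 2 * (1 - Real.exp (-(r * (u - (t₀ + Real.log 2 / r))))) ≤ s u ^ 2 := by
  set ε : ℝ := Real.exp (-(r * (u - (t₀ + Real.log 2 / r)))) with hε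
  have hε0 : 0 < ε := Real.exp_pos _
  have hε1 : ε ≤ 1 := by
    rw [hε]; apply Real.exp_le_one_iff.2
    have : 0 ≤ u - (t₀ + Real.log 2 / r) := by linarith
    nlinarith
  -- `e^{−r(u−t₀)} = ε / 2`
  have hε2 : ε = 2 * Real.exp (-(r * (u - t₀))) := by
    rw [hε, show -(r * (u - (t₀ + Real.log 2 / r))) = -(r * (u - t₀)) + Real.log 2 by
      field_simp; ring, Real.exp_add, Real.exp_log (by norm_num : (0 : ℝ) < 2)]
    ring
  have hhalf : Real.exp (-(r * (u - t₀))) = ε / 2 := by rw [hε2]; ring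
  rw [hhalf] at hs
  have h1 : 0 ≤ m * (1 - ε / 2) := mul_nonneg hm (by linarith)
  have h2 : (m * (1 - ε / 2)) ^ 2 ≤ s u ^ 2 := pow_le_pow_left₀ h1 hs 2
  have h3 : m ^ 2 * (1 - ε) ≤ (m * (1 - ε / 2)) ^ 2 := by
    have : (m * (1 - ε / 2)) ^ 2 = m ^ 2 * (1 - ε + ε ^ 2 / 4) := by ring
    rw [this]
    exact mul_le_mul_of_nonneg_left (by nlinarith) (sq_nonneg m)
  exact h3.trans h2

/-! ## The linger bound of `α_SB` -/

section Solution

variable {ε₀ ν s : ℝ} {X : Fin 4 → ℤ → ℝ → ℝ}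

/-- **A capped pocket forbids a lingering chain mode.** Along a regular solution of the `ν`-viscous
`α_SB` lattice on `[0,s]` (`ν ≥ 0`), let `[t₀,t₁] ⊆ [0,s]` and suppose on `[t₀,t₁]`: `Λ_k x_k² ≥ a ≥ 0`
(the chain mode is on), `s_k ≥ 0`, and `0 ≤ z_{k+1} ≤ Z` with `Z > 0` (the pocket is capped).  Then, with
`r₁ = Λ_k Z/5 + ν_k`,
`(Λ_k/5)·(a/(5r₁))²·((t₁ − t₀) − (1 + log 2)/r₁) ≤ Z·(1 + ν_{k+1}(t₁ − t₀))`
(`Λ_n = (1+ε₀)^{5n/2}`, `ν_n = ν(1+ε₀)^{2n}`; `ṡ_k = Λ_k(x_k² − s_k z_{k+1})/5 − ν_k s_k`,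
`ż_{k+1} = Λ_k s_k²/5 − ν_{k+1}z_{k+1}`). [this file] -/
theorem sideBranch_linger_bound (hε : 0 < ε₀) (hν : 0 ≤ ν)
    (hder : ∀ (i : Fin 4) (k : ℤ), ∀ t ∈ Icc (0 : ℝ) s, HasDerivWithinAt (X i k)
      (quadTerm ε₀ sideBranchTable X i k t - ν * (1 + ε₀) ^ ((2 : ℝ) * k) * X i k t)
      (Icc (0 : ℝ) s) t)
    (k : ℤ) {t₀ t₁ a Z : ℝ} (ht₀ : 0 ≤ t₀) (ht₀₁ : t₀ ≤ t₁) (ht₁ : t₁ ≤ s) (ha : 0 ≤ a) (hZ : 0 < Z)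
    (hx : ∀ u ∈ Icc t₀ t₁, a ≤ (1 + ε₀) ^ ((5 : ℝ) * k / 2) * X 0 k u ^ 2)
    (hsk : ∀ u ∈ Icc t₀ t₁, 0 ≤ X 1 k u)
    (hz0 : ∀ u ∈ Icc t₀ t₁, 0 ≤ X 2 (k + 1) u)
    (hzZ : ∀ u ∈ Icc t₀ t₁, X 2 (k + 1) u ≤ Z) :
    (1 / 5 : ℝ) * (1 + ε₀) ^ ((5 : ℝ) * k / 2) *
        (a / (5 * ((1 / 5 : ℝ) * (1 + ε₀) ^ ((5 : ℝ) * k / 2) * Z + ν * (1 + ε₀) ^ ((2 : ℝ) * k)))) ^ 2 *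
        ((t₁ - t₀) - (1 + Real.log 2) /
          ((1 / 5 : ℝ) * (1 + ε₀) ^ ((5 : ℝ) * k / 2) * Z + ν * (1 + ε₀) ^ ((2 : ℝ) * k))) ≤
      Z * (1 + ν * (1 + ε₀) ^ ((2 : ℝ) * ((k + 1 : ℤ) : ℝ)) * (t₁ - t₀)) := by
  have hb : (0 : ℝ) < 1 + ε₀ := by linarith
  set Λ : ℝ := (1 + ε₀) ^ ((5 : ℝ) * k / 2) with hΛ
  set c₀ : ℝ := ν * (1 + ε₀) ^ ((2 : ℝ) * k) with hc₀
  set c₁ : ℝ := ν * (1 + ε₀) ^ ((2 : ℝ) * ((k + 1 : ℤ) : ℝ)) with hc₁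
  have hΛ0 : 0 < Λ := Real.rpow_pos_of_pos hb _
  have hc₀0 : 0 ≤ c₀ := mul_nonneg hν (Real.rpow_nonneg hb.le _)
  have hc₁0 : 0 ≤ c₁ := mul_nonneg hν (Real.rpow_nonneg hb.le _)
  set r₁ : ℝ := (1 / 5 : ℝ) * Λ * Z + c₀ with hr₁def
  have hr₁ : 0 < r₁ := by
    have h1 : 0 < (1 / 5 : ℝ) * Λ * Z := by positivity
    rw [hr₁def]; linarith
  set m : ℝ := a / 5 / r₁ with hm
  have hm0 : 0 ≤ m := by positivity
  have hsub : Icc t₀ t₁ ⊆ Icc (0 : ℝ) s := Icc_subset_Icc ht₀ ht₁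
  -- Step 1: the side mode is driven: `s_k(u) ≥ m (1 − e^{−r₁(u−t₀)})`
  have hsder : ∀ u ∈ Icc t₀ t₁, HasDerivWithinAt (X 1 k)
      (quadTerm ε₀ sideBranchTable X 1 k u - c₀ * X 1 k u) (Icc t₀ t₁) u :=
    fun u hu => (hder 1 k u (hsub hu)).mono hsub
  have hsf : ∀ u ∈ Icc t₀ t₁, a / 5 - r₁ * X 1 k u ≤
      quadTerm ε₀ sideBranchTable X 1 k u - c₀ * X 1 k u := by
    intro u hu
    rw [sideBranch_quadTerm_one, ← hΛ]
    have h1 : X 1 k u * X 2 (k + 1) u ≤ X 1 k u * Z := mul_le_mul_of_nonneg_left (hzZ u hu) (hsk u hu)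
    have h2 : (1 / 5 : ℝ) * Λ * (X 1 k u * X 2 (k + 1) u) ≤ (1 / 5 : ℝ) * Λ * (X 1 k u * Z) :=
      mul_le_mul_of_nonneg_left h1 (by positivity)
    have h3 : r₁ * X 1 k u = (1 / 5 : ℝ) * Λ * (X 1 k u * Z) + c₀ * X 1 k u := by rw [hr₁def]; ring
    have h4 := hx u hu
    have h5 : a / 5 ≤ (1 / 5 : ℝ) * Λ * X 0 k u ^ 2 := by rw [hΛ]; linarith
    linarith
  have hs0 : 0 ≤ X 1 k t₀ := hsk t₀ (left_mem_Icc.2 ht₀₁)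
  have hdrive : ∀ u ∈ Icc t₀ t₁, m * (1 - Real.exp (-(r₁ * (u - t₀)))) ≤ X 1 k u := by
    intro u hu
    have h := sideBranch_drive_lower_bound hr₁ hsder hsf hs0 hu
    rwa [hm]
  -- the delayed window `[t₀', t₁]`, `t₀' = t₀ + log 2 / r₁`
  set t₀' : ℝ := t₀ + Real.log 2 / r₁ with ht₀'
  have hlog2 : 0 ≤ Real.log 2 := Real.log_nonneg (by norm_num)
  have ht₀t₀' : t₀ ≤ t₀' := by
    have h1 : 0 ≤ Real.log 2 / r₁ := by positivity
    rw [ht₀']; linarith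
  by_cases hcase : t₀' ≤ t₁
  · -- Step 2: on `[t₀', t₁]`, `s_k² ≥ m²(1 − e^{−r₁(u − t₀')})`
    have hsub' : Icc t₀' t₁ ⊆ Icc t₀ t₁ := Icc_subset_Icc ht₀t₀' le_rfl
    have hsq : ∀ u ∈ Icc t₀' t₁, m ^ 2 * (1 - Real.exp (-(r₁ * (u - t₀')))) ≤ X 1 k u ^ 2 :=
      fun u hu => sideBranch_sq_lower_of_drive hm0 hr₁ (hdrive u (hsub' hu)) hu.1
    -- Step 3: the pocket integrates `s_k²`: `G = z_{k+1} + c₁ Z u`, `G' ≥ (Λ/5) s_k²`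
    have hsub'' : Icc t₀' t₁ ⊆ Icc (0 : ℝ) s := hsub'.trans hsub
    have hG : ∀ u ∈ Icc t₀' t₁, HasDerivWithinAt (fun u => X 2 (k + 1) u + c₁ * Z * u)
        ((quadTerm ε₀ sideBranchTable X 2 (k + 1) u - c₁ * X 2 (k + 1) u) + c₁ * Z * 1)
        (Icc t₀' t₁) u :=
      fun u hu => ((hder 2 (k + 1) u (hsub'' hu)).mono hsub'').add
        ((hasDerivWithinAt_id u _).const_mul (c₁ * Z))
    have hG' : ∀ u ∈ Icc t₀' t₁, (1 / 5 : ℝ) * Λ * X 1 k u ^ 2 ≤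
        (quadTerm ε₀ sideBranchTable X 2 (k + 1) u - c₁ * X 2 (k + 1) u) + c₁ * Z * 1 := by
      intro u hu
      rw [sideBranch_quadTerm_two_succ, ← hΛ]
      have h1 : c₁ * X 2 (k + 1) u ≤ c₁ * Z := mul_le_mul_of_nonneg_left (hzZ u (hsub' hu)) hc₁0
      linarith
    have hgain := sideBranch_drive_gain (G := fun u => X 2 (k + 1) u + c₁ * Z * u) hr₁
      (by positivity : (0 : ℝ) ≤ (1 / 5 : ℝ) * Λ) (sq_nonneg m) hG hG' hsq hcase
    -- evaluate: `z(t₁) ≤ Z`, `z(t₀') ≥ 0`, `t₁ − t₀' − 1/r₁ = (t₁ − t₀) − (1 + log 2)/r₁`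
    have hz1 := hzZ t₁ (right_mem_Icc.2 ht₀₁)
    have hz0' := hz0 t₀' ⟨ht₀t₀', hcase⟩
    have hwin : t₁ - t₀' - 1 / r₁ = (t₁ - t₀) - (1 + Real.log 2) / r₁ := by
      rw [ht₀']; field_simp; ring
    rw [hwin] at hgain
    have hΔ : c₁ * Z * t₁ - c₁ * Z * t₀' ≤ c₁ * Z * (t₁ - t₀) := by
      have : c₁ * Z * (t₀' - t₀) ≥ 0 := mul_nonneg (mul_nonneg hc₁0 hZ.le) (by linarith)
      nlinarith
    have hfin : (1 / 5 : ℝ) * Λ * m ^ 2 * ((t₁ - t₀) - (1 + Real.log 2) / r₁) ≤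
        Z * (1 + c₁ * (t₁ - t₀)) := by nlinarith [hgain, hz1, hz0', hΔ]
    simpa only [hm, hr₁def, hΛ, hc₀, hc₁, div_div] using hfin
  · -- the window is shorter than the delay: the left side is `≤ 0 ≤` the right side
    rw [not_le] at hcase
    have hneg : (t₁ - t₀) - (1 + Real.log 2) / r₁ ≤ 0 := by
      have h1 : t₁ - t₀ < Real.log 2 / r₁ := by rw [ht₀'] at hcase; linarith
      have h2 : Real.log 2 / r₁ ≤ (1 + Real.log 2) / r₁ :=
        div_le_div_of_nonneg_right (by linarith) hr₁.le
      linarith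
    have hL : (1 / 5 : ℝ) * Λ * m ^ 2 * ((t₁ - t₀) - (1 + Real.log 2) / r₁) ≤ 0 :=
      mul_nonpos_of_nonneg_of_nonpos (by positivity) hneg
    have hR : 0 ≤ Z * (1 + c₁ * (t₁ - t₀)) :=
      mul_nonneg hZ.le (by nlinarith [mul_nonneg hc₁0 (sub_nonneg.2 ht₀₁)])
    have hfin : (1 / 5 : ℝ) * Λ * m ^ 2 * ((t₁ - t₀) - (1 + Real.log 2) / r₁) ≤
        Z * (1 + c₁ * (t₁ - t₀)) := hL.trans hR
    simpa only [hm, hr₁def, hΛ, hc₀, hc₁, div_div] using hfin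

end Solution

end Summit.NavierStokesRegularity.NavierStokesRegularity.Theorems.SubOnsagerCeiling

end
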